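import Literature.AnabelianGeometry.SemiGraphs.Arithmetic
import Literature.AnabelianGeometry.SemiGraphs.ArithMaximalCompact
import Literature.AnabelianGeometry.SemiGraphs.TemperedCurves
import Literature.AnabelianGeometry.SemiGraphs.TemperedAnabelian
import Mathlib.Topology.Algebra.Group.Quotient

/-!
# Pointed stable curves over `p`-adic local fields II ([SemiAnbd] §5: Example 5.6, Rmk 5.6.1)

Mochizuki, *Semi-graphs of anabelioids*, Publ. RIMS **42** (2006), §5 Example 5.6 pp.67–68 of the
author's manuscript (kurims `paper:url-f33ace170ff4`); the notation is that of Example 3.10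
(pp.43–45), whose interface `TemperedArithmeticGroup K` (`Π := π₁^temp(X^log_K) ↠ G_K`,
`Δ := Ker`) is owned by abc-iut-L3-t2 (`TemperedCurves.lean`).
[cite: MochizukiSemiAnbd2006, Ex 5.6, p. 67]

Per the layer lead's RULING ε (2026-08-25): the Example 5.6 tower is a structure PARAMETRISED by
`D : TemperedArithmeticGroup K` (no `extends`), `StableReductionTower 𝓥 D`, whose fields are exactly
the data the Example introduces:
* "an exhaustive sequence of open characteristic [hence normal] subgroups of finite index
  `… ⊆ M_i ⊆ … ⊆ Π` [`i` over the positive integers; here `ℕ`]" with `N_i := M_i ∩ Δ`,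
  `Π_i := Π/M_i`, chosen so that the covering determined by `M_i` "has stable reduction over the ring
  of integers of the finite extension of `K` that it determines" (a condition on the CHOICE, part of
  the geometric origin of the data — not a field);
* the arithmetic semi-graphs of anabelioids `𝔊_i`, `𝔊^c_i` (Def 5.1 (ii)) "with underlying
  semi-graphs of anabelioids `𝒢_i`, `𝒢^c_i`" of Example 3.10 (special fibres of the coverings), whose
  arithmetic action is the one "the outer action of `M_i` on `N_i` determines" — so the arithmetic
  component's fundamental group is `M_i/N_i ↪ Π/Δ = G_K` (fields `arithEmb`, `range_arithEmb`);
* the "admissible quotients" `N_i ↠ π₁^temp(𝒢_i)` of Example 3.10 / Rmk 3.11.2, recorded by their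
  kernels `admKer i ≤ N_i`, normal in `M_i`, so that `Π^temp_{𝔊_i} = M_i / admKer i` carries the
  natural maps `Π^temp_{𝔊_i} → Π^temp_{𝔊_j}` (`i ≥ j`);
* representatives of the verticial / edge-like decomposition groups in `Π^temp_{𝔊_i}`
  (`DecompositionData`, Def 5.3 (iii); TODO-merge abc-iut-L3-t2 Thm 3.7);
* "the map on geometric special fibers between the coverings" on components (the object part of
  the functor `Cat(𝒢_i) → Cat(𝒢_j)`, Example 3.10 p.44: a vertex goes to a vertex or an edge, an edge
  to a vertex or an edge) — fields `spV`, `spE`.  The full "generalized morphisms of graphs of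
  anabelioids" (Def 2.11; abc-iut-L3-t4's `ProSigmaCompletion.lean`) are TODO-merge.

ORIGIN GUARD (cell RULING σ; this revision supersedes p405547).  The tower record leaves `𝔊`, `𝔊c`,
`dec`, `decc`, `sp*` as FREE data, whereas the print asserts the Example's properties of the
GEOMETRICALLY DETERMINED data only ("write `𝔊_i`, `𝔊^c_i` for the arithmetic semi-graphs of anabelioids
[of Example 3.10] associated to the special fibres"); a statement `∀ T : StableReductionTower 𝓥 D, …`
would therefore be refuted by junk towers over a genuine `D` (e.g. all decomposition groups `:= ⊤`).
Hence the §5-local origin structure `StableReductionOrigin 𝓥 K extends TemperedPiOrigin K` (t2's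
frozen `TemperedCurves.lean` is not touched) with the certificate `Ω.IsStableReductionTowerOf D T`
("`T` IS the tower of Example 5.6 for the curve whose `π₁^temp` is `D`"), and every statement below
has the shape `∀ D, Ω.IsOfGeometricOrigin D → ∀ T, Ω.IsStableReductionTowerOf D T → …` (rigidity
statements: both towers certified).  Over it the Example's CLAIM — "the generalized morphisms
`𝔊_i → 𝔊_j` may be recovered group-theoretically from `Π^temp_{𝔊_i} → Π^temp_{𝔊_j}` as follows: [a
vertex/edge whose verticial/edge-like subgroup maps into an edge-like subgroup `H` goes to the edge
of `H`; otherwise into a verticial subgroup `H`, and it goes to the vertex of `H`] … these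
characterizations make sense and … yield the map on objects" — is typed as the `Prop`
`Ex56ObjectRecipeStatement` (object part; "the remainder of the data … determined naturally by
considering the maps between the various verticial and edge-like subgroups" is recorded, not
typed), and the assertions "`𝔊_i`, `𝔊^c_i` are connected, finite, totally elevated, totally universally
sub-coverticial … totally arithmetically estranged" as `Ex56PropertiesStatement` (for BOTH `𝔊_i` and
`𝔊^c_i`: the decomposition groups of `𝒢^c_i` live in the same group `Π^temp_{𝔊_i}`, since
`B^temp(𝒢) ⥲ B^temp(𝒢^c)` naturally, Example 3.10 p.44 — field `decc`).  Never asserted.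

The `𝔊^c`-version of the claim ("by a similar argument, together with the technique of Corollary
3.11, one may reconstruct the generalized morphisms `𝔊^c_i → 𝔊^c_j` group-theoretically from the
corresponding morphisms of tempered groups `M_i → M_j`"), whose recipe is not spelled out in print,
and **Rmk 5.6.1** (its "immediate profinite generalization … from `M_i^∧ → M_j^∧`", via [Mzk3]
Lemma 2.3) are typed in RIGIDITY FORM (FOUNDATIONS row 41: reconstruction = functoriality on
isomorphisms): an isomorphism of the group data carrying the tower `(M_i)` to the tower `(M'_i)`
is accompanied by isomorphisms of the arithmetic semi-graphs of anabelioids `𝔊^c_i ≅ 𝔊'^c_i`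
compatible with the specialisation maps — `Ex56CompactRigidityStatement`, `Rmk561RigidityStatement`
(the latter over explicit profinite-completion maps, the tree's `IsProfiniteCompletion` of
`TemperedAnabelian.lean`, WITH the Galois augmentations `Π̂ → G_K` they carry and an `α` over `G_K`:
the printed input is "the Galois action on the geometric profinite fundamental group", [Mzk3]
Lemma 2.3).  TODO(general form): print (via Cor 3.11) compares curves over possibly different
finite extensions `K_α`, `K_β` of `ℚ_p`; typed here over one base field `K`.  MERGE note: the
levels `𝔊_i`, `𝔊^c_i` live in the §§1–3 container `SemiAnbdVocab`; abc-iut-L3-t2's special-fibre data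
of a single curve (`SpecialFibreData D`, file `TemperedSpecialFibre.lean`, over its own
`ProfiniteSemiGraph` presentation) is the `i = 0`, `𝔊^c` level and is to be identified with it in the
layer's merge pass.  Nothing in this file asserts a result of the paper.
-/

namespace Literature.AnabelianGeometry.SemiGraphs

open _root_.CategoryTheory Literature.AlgebraicGeometry.Frobenioids

universe u v w u'

variable {Obj : Type u} [Category.{v} Obj] (𝓥 : SemiAnbdVocab.{u, v, w} Obj)
variable {K : Type u'} [Field K]

/-- The arithmetic tempered fundamental group `Π^temp_{𝔊_i} := M_i / admKer_i` attached to a level of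
a tower (Example 5.6 with Prop 5.2 (iv): `1 → π₁^temp(𝒢_i) = N_i/admKer_i → M_i/admKer_i → M_i/N_i → 1`).
[cite: MochizukiSemiAnbd2006, Ex 5.6, p. 67] -/
abbrev towerGroup {P : Type*} [Group P] (M A : Subgroup P) : Type _ := M ⧸ A.subgroupOf M

/-- **Example 5.6, the data** (RULING ε: parametrised by t2's `TemperedArithmeticGroup`): an
exhaustive decreasing sequence `M_i` of open characteristic subgroups of finite index of
`Π = π₁^temp(X^log_K)` (with `N_i := M_i ∩ Δ`), the arithmetic semi-graphs of anabelioids `𝔊_i`, `𝔊^c_i`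
of the special fibres with arithmetic fundamental groups `M_i/N_i ↪ G_K`, the admissible quotients
`N_i ↠ π₁^temp(𝒢_i)` (by their kernels), decomposition-group representatives in `Π^temp_{𝔊_i}`, and the
specialisation maps on components `𝒢_i ⇝ 𝒢_j` (`i ≥ j`). [cite: MochizukiSemiAnbd2006, Ex 5.6, p. 67] -/
structure StableReductionTower (D : TemperedArithmeticGroup K) where
  /-- the subgroups `M_i ⊆ Π` -/
  M : ℕ → Subgroup D.Pi
  /-- each `M_i` is open -/
  isOpen_M : ∀ i, IsOpen (M i : Set D.Pi)
  /-- each `M_i` has finite index -/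
  finiteIndex_M : ∀ i, (M i).FiniteIndex
  /-- each `M_i` is characteristic (stable under every topological automorphism of `Π`) -/
  characteristic_M : ∀ (i : ℕ) (φ : D.Pi ≃ₜ* D.Pi), (M i).map φ.toMonoidHom = M i
  /-- the sequence decreases: `M_j ⊆ M_i` for `i ≤ j` -/
  antitone_M : Antitone M
  /-- the sequence is exhaustive -/
  exhaustive_M : ⨅ i, M i = ⊥
  /-- `𝔊_i`: the arithmetic graph of anabelioids of the special fibre of the `i`-th covering -/
  𝔊 : ℕ → ArithSemiGraph 𝓥
  /-- `𝔊^c_i`: the same with compact structure (cusps as open edges) -/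
  𝔊c : ℕ → ArithSemiGraph 𝓥
  /-- `π̂₁(A_i) ↪ G_K`: the arithmetic component of `𝔊_i` is `M_i/N_i ⊆ Π/Δ = G_K` -/
  arithEmb : ∀ i, (𝔊 i).PA →* Field.absoluteGaloisGroup K
  /-- it is continuous -/
  continuous_arithEmb : ∀ i, Continuous (arithEmb i)
  /-- it is injective -/
  injective_arithEmb : ∀ i, Function.Injective (arithEmb i)
  /-- its image is the image of `M_i` in `G_K` -/
  range_arithEmb : ∀ i, (arithEmb i).range = (M i).map D.aug.toMonoidHom
  /-- the same for `𝔊^c_i` ("the same arithmetic component") -/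
  arithEmbc : ∀ i, (𝔊c i).PA →* Field.absoluteGaloisGroup K
  /-- continuity -/
  continuous_arithEmbc : ∀ i, Continuous (arithEmbc i)
  /-- injectivity -/
  injective_arithEmbc : ∀ i, Function.Injective (arithEmbc i)
  /-- image -/
  range_arithEmbc : ∀ i, (arithEmbc i).range = (M i).map D.aug.toMonoidHom
  /-- the kernel of the admissible quotient `N_i ↠ π₁^temp(𝒢_i)` (Example 3.10, Rmk 3.11.2) -/
  admKer : ℕ → Subgroup D.Pi
  /-- it lies in `N_i = M_i ∩ Δ` -/
  admKer_le : ∀ i, admKer i ≤ M i ⊓ D.delta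
  /-- it is normal in `M_i` (so `Π^temp_{𝔊_i} := M_i / admKer_i` is a group) -/
  admKer_normal : ∀ i, ((admKer i).subgroupOf (M i)).Normal
  /-- compatibility along the tower: for `j ≤ i` (so `M_i ⊆ M_j`) the inclusion induces
  `Π^temp_{𝔊_i} → Π^temp_{𝔊_j}`, i.e. `admKer_i ⊆ admKer_j` -/
  admKer_mono : ∀ i j, j ≤ i → admKer i ≤ admKer j
  /-- representatives of the decomposition groups of vertices and branches of `𝒢_i` in
  `Π^temp_{𝔊_i}` (Def 5.3 (iii); construction TODO-merge abc-iut-L3-t2, Thm 3.7) -/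
  dec : ∀ i, DecompositionData (towerGroup (M i) (admKer i)) (𝓥.Vert (𝔊 i).G)
    (Σ e : 𝓥.Edge (𝔊 i).G, 𝓥.Br e)
  /-- representatives of the decomposition groups of vertices and branches (of nodes AND cusps) of
  `𝒢^c_i` in the same group `Π^temp_{𝔊^c_i} = Π^temp_{𝔊_i}` (Example 3.10 p.44: "a natural
  equivalence `B^temp(𝒢) ⥲ B^temp(𝒢^c)`"; Def 5.3 (iii)) -/
  decc : ∀ i, DecompositionData (towerGroup (M i) (admKer i)) (𝓥.Vert (𝔊c i).G)
    (Σ e : 𝓥.Edge (𝔊c i).G, 𝓥.Br e)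
  /-- the specialisation map on vertices of `𝒢_i` to components of `𝒢_j` (`j ≤ i`), Example 3.10
  p.44: a vertex goes to the vertex or to the node its irreducible component maps into -/
  spV : ∀ i j, j ≤ i → 𝓥.Vert (𝔊 i).G → 𝓥.Vert (𝔊 j).G ⊕ 𝓥.Edge (𝔊 j).G
  /-- the specialisation map on edges of `𝒢_i` (a node goes to a non-nodal point of a component, or
  to a node) -/
  spE : ∀ i j, j ≤ i → 𝓥.Edge (𝔊 i).G → 𝓥.Vert (𝔊 j).G ⊕ 𝓥.Edge (𝔊 j).G
  /-- the specialisation map on vertices for the semi-graphs with compact structure `𝒢^c_i` -/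
  spVc : ∀ i j, j ≤ i → 𝓥.Vert (𝔊c i).G → 𝓥.Vert (𝔊c j).G ⊕ 𝓥.Edge (𝔊c j).G
  /-- the specialisation map on edges (nodes and cusps) for `𝒢^c_i` -/
  spEc : ∀ i j, j ≤ i → 𝓥.Edge (𝔊c i).G → 𝓥.Vert (𝔊c j).G ⊕ 𝓥.Edge (𝔊c j).G

namespace StableReductionTower

variable {𝓥} {D : TemperedArithmeticGroup K} (T : StableReductionTower 𝓥 D)

/-- `N_i := M_i ∩ Δ` (Example 5.6 p.67). [cite: MochizukiSemiAnbd2006, Ex 5.6, p. 67] -/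
noncomputable def N (i : ℕ) : Subgroup D.Pi := T.M i ⊓ D.delta

/-- `Π^temp_{𝔊_i} := M_i / admKer_i`, the arithmetic tempered fundamental group at level `i`.
[cite: MochizukiSemiAnbd2006, Ex 5.6, p. 67] -/
abbrev Gtp (i : ℕ) : Type _ := towerGroup (T.M i) (T.admKer i)

/-- `admKer_i` is normal in `M_i` (field `admKer_normal`, as an instance so that `M_i / admKer_i` is a
group). [cite: MochizukiSemiAnbd2006, Ex 5.6, p. 67] -/
instance admKer_subgroupOf_normal (i : ℕ) : ((T.admKer i).subgroupOf (T.M i)).Normal :=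
  T.admKer_normal i

/-- The natural map `Π^temp_{𝔊_i} → Π^temp_{𝔊_j}` for `j ≤ i`, induced by `M_i ⊆ M_j` and
`admKer_i ⊆ admKer_j`. [cite: MochizukiSemiAnbd2006, Ex 5.6, p. 67] -/
def transition (i j : ℕ) (h : j ≤ i) : T.Gtp i →* T.Gtp j :=
  QuotientGroup.map _ _ (Subgroup.inclusion (T.antitone_M h)) (by
    intro x hx
    simp only [Subgroup.mem_subgroupOf, Subgroup.mem_comap, Subgroup.coe_inclusion] at hx ⊢
    exact T.admKer_mono i j h hx)

/-- The augmentation `Π^temp_{𝔊_i} → G_K`, `m ↦ (image of m in G_K)`, with image `M_i/N_i = π̂₁(A_i)`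
(Prop 5.2 (iv) at level `i`). [cite: MochizukiSemiAnbd2006, Ex 5.6, p. 67] -/
noncomputable def augmentation (i : ℕ) : T.Gtp i →* Field.absoluteGaloisGroup K :=
  QuotientGroup.lift _ (D.aug.toMonoidHom.comp (T.M i).subtype) (by
    intro x hx
    have hx' : (x : D.Pi) ∈ T.admKer i := by simpa [Subgroup.mem_subgroupOf] using hx
    have := (T.admKer_le i hx').2
    simpa [TemperedArithmeticGroup.delta] using this)

end StableReductionTower

/-! ### The origin certificate for towers (cell RULING σ) -/

/-- ORIGIN hypothesis structure for Example 5.6 (§5-local; extends abc-iut-L3-t2's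
`TemperedPiOrigin K` without touching it): besides "`D` is `π₁^temp(X^log_K)` of a smooth log curve"
(`IsOfGeometricOrigin`), the certificate `IsStableReductionTowerOf D T` reads "`T` IS the tower of
Example 5.6 (p.67) for that curve": the `T.M i` are open characteristic subgroups of finite index
chosen so that the coverings they determine "ha[ve] stable reduction over the ring of integers of
the finite extension of `K` that [they] determine"; `T.𝔊 i`, `T.𝔊c i` ARE "the arithmetic
semi-graphs of anabelioids `𝔊_i`, `𝔊^c_i` with underlying semi-graphs of anabelioids `𝒢_i`, `𝒢^c_i`"
of Example 3.10 "associated to the geometric special fiber of the stable model" of those coverings,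
with the arithmetic action "the outer action of `M_i` on `N_i` determines"; `T.admKer i` is the
kernel of the admissible quotient `N_i ↠ π₁^temp(𝒢_i)` (Example 3.10 p.45); `T.dec i`, `T.decc i`
are the decomposition groups of p.65 / Prop 5.2 (iv) / Thm 3.7; `T.spV/spE/spVc/spEc` are the
object maps of the functors `Cat(𝒢_i) → Cat(𝒢_j)` induced by "the map on geometric special fibers
between the coverings" (Example 3.10 p.44).  An uninterpreted certificate carried as a PARAMETER,
never constructed in the tree (FOUNDATIONS rows 13–14: André's `π₁^temp`, stable reduction); every
statement below is asserted only for certified `(D, T)`.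
[cite: MochizukiSemiAnbd2006, Ex 5.6, p. 67] -/
structure StableReductionOrigin (K : Type u') [Field K] extends TemperedPiOrigin K where
  /-- "`T` is the stable-reduction tower of Example 5.6 of the curve whose `π₁^temp ↠ G_K` is `D`" -/
  IsStableReductionTowerOf : (D : TemperedArithmeticGroup K) → StableReductionTower 𝓥 D → Prop
  /-- a certified tower sits over a `D` of geometric origin (Example 5.6 "work[s] in the notation
  of Example 3.10") -/
  isOfGeometricOrigin_of_isStableReductionTowerOf : ∀ (D : TemperedArithmeticGroup K)
    (T : StableReductionTower 𝓥 D), IsStableReductionTowerOf D T → IsOfGeometricOrigin D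

/-! ### Example 5.6 — the printed assertions, as statements guarded by the origin certificates -/

section Statements

variable {𝓥}
variable (Ω : StableReductionOrigin 𝓥 K)

/-- **Example 5.6**, properties asserted of the levels: "`𝔊_i`, `𝔊^c_i` are connected, finite, totally
elevated, and totally universally sub-coverticial [cf. Example 3.10].  Also, it follows immediately
from Lemma 5.5 that `𝔊_i`, `𝔊^c_i` are totally arithmetically estranged.  In particular, [at least for `i`
sufficiently large] `𝔊_i` satisfies the hypotheses of Theorem 5.4."  (Connectedness is built into
`ArithSemiGraph`; arithmetic estrangement is Def 5.3 (ii) on the level-`i` decomposition data of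
`𝒢_i`, resp. `𝒢^c_i`.)  Asserted only for a certified tower over a certified `D`.
[cite: MochizukiSemiAnbd2006, Ex 5.6, p. 67] -/
def Ex56PropertiesStatement (Ω : StableReductionOrigin 𝓥 K) : Prop :=
  ∀ (D : TemperedArithmeticGroup K), Ω.IsOfGeometricOrigin D →
    ∀ (T : StableReductionTower 𝓥 D), Ω.IsStableReductionTowerOf D T → ∀ (i : ℕ),
      (𝓥.IsFinite (T.𝔊 i).G ∧ 𝓥.IsTotallyElevated (T.𝔊 i).G ∧
          𝓥.IsTotallyUnivSubcoverticial (T.𝔊 i).G ∧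
            IsTotallyArithEstranged (T.dec i) (T.augmentation i)) ∧
        𝓥.IsFinite (T.𝔊c i).G ∧ 𝓥.IsTotallyElevated (T.𝔊c i).G ∧
          𝓥.IsTotallyUnivSubcoverticial (T.𝔊c i).G ∧
            IsTotallyArithEstranged (T.decc i) (T.augmentation i)

/-- **Example 5.6, the CLAIM** (object part of the group-theoretic recovery of `𝔊_i → 𝔊_j`, `i ≥ j`):
"if `v` (resp. `e`) is a vertex (resp. edge) of `𝒢_i` such that the image in `Π^temp_{𝔊_j}` of the
verticial (resp. edge-like) subgroup determined by `v` (resp. `e`) is contained in a [necessarily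
unique] edge-like subgroup `H` of `Π^temp_{𝔊_j}`, then [the functor `Cat(𝒢_i) → Cat(𝒢_j)`] maps `v` (resp.
`e`) to the edge of `𝒢_j` determined by `H`.  On the other hand, if … is not contained in an edge-like
subgroup … but is contained in a verticial subgroup `H` of `Π^temp_{𝔊_j}`, then this functor maps `v`
(resp. `e`) to the vertex of `𝒢_j` determined by `H`.  That these characterizations make sense and …
yield the map on objects … follows from Theorem 5.4 (i), (ii); Lemma 5.5."  Asserted only for a
certified tower over a certified `D`. [cite: MochizukiSemiAnbd2006, Ex 5.6, pp. 67–68] -/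
def Ex56ObjectRecipeStatement (Ω : StableReductionOrigin 𝓥 K) : Prop :=
  ∀ (D : TemperedArithmeticGroup K), Ω.IsOfGeometricOrigin D →
    ∀ (T : StableReductionTower 𝓥 D), Ω.IsStableReductionTowerOf D T → ∀ (i j : ℕ) (h : j ≤ i),
      let φ := T.transition i j h
      let Dj := T.dec j
      -- vertices of `𝒢_i`
      (∀ v : 𝓥.Vert (T.𝔊 i).G,
        let img := ((T.dec i).vertGp v).map φ
        (∃ K : Subgroup (T.Gtp j), (IsVerticial Dj K ∨ IsEdgeLike Dj K) ∧ img ≤ K) ∧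
        (∀ (b : Σ e : 𝓥.Edge (T.𝔊 j).G, 𝓥.Br e) (g : T.Gtp j),
            img ≤ conjSubgroup g (Dj.brGp b) → T.spV i j h v = Sum.inr b.1) ∧
        (∀ (w : 𝓥.Vert (T.𝔊 j).G) (g : T.Gtp j), img ≤ conjSubgroup g (Dj.vertGp w) →
            (¬ ∃ K, IsEdgeLike Dj K ∧ img ≤ K) → T.spV i j h v = Sum.inl w)) ∧
      -- edges of `𝒢_i` (edge-like subgroup of `e` = that of either of its branches)
      ∀ (x : Σ e : 𝓥.Edge (T.𝔊 i).G, 𝓥.Br e),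
        let img := ((T.dec i).brGp x).map φ
        (∃ K : Subgroup (T.Gtp j), (IsVerticial Dj K ∨ IsEdgeLike Dj K) ∧ img ≤ K) ∧
        (∀ (b : Σ e : 𝓥.Edge (T.𝔊 j).G, 𝓥.Br e) (g : T.Gtp j),
            img ≤ conjSubgroup g (Dj.brGp b) → T.spE i j h x.1 = Sum.inr b.1) ∧
        (∀ (w : 𝓥.Vert (T.𝔊 j).G) (g : T.Gtp j), img ≤ conjSubgroup g (Dj.vertGp w) →
            (¬ ∃ K, IsEdgeLike Dj K ∧ img ≤ K) → T.spE i j h x.1 = Sum.inl w)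

/-- Compatibility of a family of isomorphisms `φ_i : 𝔊^c_i ⥲ 𝔊'^c_i` with the specialisation maps of two
towers (the object part of "compatible with the generalized morphisms `𝔊^c_i → 𝔊^c_j`").
[cite: MochizukiSemiAnbd2006, Ex 5.6, p. 68] -/
def StableReductionTower.CompatibleIsos {D D' : TemperedArithmeticGroup K}
    (T : StableReductionTower 𝓥 D) (T' : StableReductionTower 𝓥 D')
    (φ : ∀ i, ArithHom 𝓥 (T.𝔊c i) (T'.𝔊c i)) : Prop :=
  (∀ i, (φ i).IsIsomorphism) ∧
    ∀ (i j : ℕ) (h : j ≤ i),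
      (∀ v, T'.spVc i j h (𝓥.mapV (φ i).geom v) =
          Sum.map (𝓥.mapV (φ j).geom) (𝓥.mapE (φ j).geom) (T.spVc i j h v)) ∧
        ∀ e, T'.spEc i j h (𝓥.mapE (φ i).geom e) =
          Sum.map (𝓥.mapV (φ j).geom) (𝓥.mapE (φ j).geom) (T.spEc i j h e)

/-- **Example 5.6, the `𝔊^c`-claim in rigidity form**: "one may reconstruct the generalized morphisms
of arithmetic semi-graphs of anabelioids `𝔊^c_i → 𝔊^c_j` group-theoretically from the corresponding
morphisms of tempered groups `M_i → M_j`" — an isomorphism of tempered groups `Π ⥲ Π'` over `G_K`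
carrying each `M_i` onto `M'_i` comes with isomorphisms `𝔊^c_i ⥲ 𝔊'^c_i` compatible with the
specialisation maps.  Asserted only for certified towers over certified `D`, `D'`.
[cite: MochizukiSemiAnbd2006, Ex 5.6, p. 68] -/
def Ex56CompactRigidityStatement (Ω : StableReductionOrigin 𝓥 K) : Prop :=
  ∀ (D D' : TemperedArithmeticGroup K), Ω.IsOfGeometricOrigin D → Ω.IsOfGeometricOrigin D' →
    ∀ (T : StableReductionTower 𝓥 D) (T' : StableReductionTower 𝓥 D'),
      Ω.IsStableReductionTowerOf D T → Ω.IsStableReductionTowerOf D' T' →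
        ∀ (α : D.Pi ≃ₜ* D'.Pi),
          (∀ g, D'.aug (α g) = D.aug g) → (∀ i, (T.M i).map α.toMonoidHom = T'.M i) →
            ∃ φ : ∀ i, ArithHom 𝓥 (T.𝔊c i) (T'.𝔊c i), T.CompatibleIsos T' φ

/-- **Rmk 5.6.1 in rigidity form**: "there is an immediate profinite generalization of the
group-theoretic reconstruction in Example 5.6 of the generalized morphism `𝔊^c_i → 𝔊^c_j` from the
corresponding morphism of profinite groups `M_i^∧ → M_j^∧` [where `∧` denotes profinite completion]"
— "from the Galois action on the geometric profinite fundamental group [cf. [Mzk3], Lemma 2.3]":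
over explicit profinite-completion maps `ι`, `ι'` of `Π`, `Π'` (the tree's `IsProfiniteCompletion`,
`TemperedAnabelian.lean`) TOGETHER WITH the Galois augmentations `Π̂ → G_K`, `Π̂' → G_K` extending
those of `Π`, `Π'`, an isomorphism of the completions OVER `G_K` carrying the closure of `ι(M_i)` onto
that of `ι'(M'_i)` for every `i` comes with isomorphisms `𝔊^c_i ⥲ 𝔊'^c_i` compatible with the
specialisation maps.  Asserted only for certified towers over certified `D`, `D'`.
[cite: MochizukiSemiAnbd2006, Rmk 5.6.1, p. 68] -/
def Rmk561RigidityStatement (Ω : StableReductionOrigin 𝓥 K) : Prop :=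
  ∀ (D D' : TemperedArithmeticGroup K), Ω.IsOfGeometricOrigin D → Ω.IsOfGeometricOrigin D' →
    ∀ (T : StableReductionTower 𝓥 D) (T' : StableReductionTower 𝓥 D'),
      Ω.IsStableReductionTowerOf D T → Ω.IsStableReductionTowerOf D' T' →
        ∀ (P P' : ProfiniteGrp.{u'}) (ι : D.Pi →ₜ* P) (ι' : D'.Pi →ₜ* P')
          (augP : P →ₜ* Field.absoluteGaloisGroup K) (augP' : P' →ₜ* Field.absoluteGaloisGroup K),
          IsProfiniteCompletion ι → IsProfiniteCompletion ι' →
            (∀ g, augP (ι g) = D.aug g) → (∀ g, augP' (ι' g) = D'.aug g) →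
              ∀ α : P ≃ₜ* P', (∀ x, augP' (α x) = augP x) →
                (∀ i, (((T.M i).map ι.toMonoidHom).topologicalClosure).map α.toMonoidHom =
                    ((T'.M i).map ι'.toMonoidHom).topologicalClosure) →
                  ∃ φ : ∀ i, ArithHom 𝓥 (T.𝔊c i) (T'.𝔊c i), T.CompatibleIsos T' φ

end Statements

end Literature.AnabelianGeometry.SemiGraphs
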